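import Mathlib
import HarnessLib
import Summits.NavierStokesRegularity.NavierStokesRegularity.Theorems.HalfSpaceWindowDoorCirculationCarryingRigidityRadConeRigidity

/-!
# Route `HalfSpaceWindowDoor`, crux `CirculationCarryingRigidity` (stmt-NavierStokesRegularity-25311) —
# line `cone_sweep`, TRANSPORT form, Step 3: a disc saturating the circulation of ONE PLANE empties that plane (no cone at all)

LEAD ns-hsw-p1 g9, `--supports stmt-NavierStokesRegularity-25311 --as helper`; card `Cruxes/…/Lines/cone_sweep.md`.  The cone-line device of
p682589 / p684322 / p685866 (Lei–Ren–Tian's Step 3) is REDUNDANT for analytic slices: if on the slice `s₀` the disc `D(R, z₀)` SATURATES the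
circulation of its own plane (`Γ(R,z₀,s₀) = S ≥ Γ(r,z₀,s₀)` for all `r ≥ 0`), then `Γ(·,z₀,s₀) ≡ S` beyond `R` (radial monotonicity, `ω₃ ≥ 0`),
so `ω₃(s₀,·) = 0` on the planar region `{r > R}` of the plane `{x₃ = z₀}` (`…RadConeRigidity.inner_curl_e3_eq_zero_on_circle_of_const`), and
the restriction of the real-analytic slice `ω₃(s₀,·)` to each horizontal LINE of that plane is a real-analytic function of one variable vanishing
on a half-line, hence identically: **`ω₃(s₀,·) ≡ 0` on the plane `{x₃ = z₀}` and `Γ(·,z₀,s₀) ≡ 0`, in particular `S = 0`**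
(`inner_curl_e3_eq_zero_of_saturated_plane`, `circ_eq_zero_of_saturated_plane`).  No cone, no hypothesis off the plane.
Consumed by `…TransportLiouville`.  WHAT THIS IS NOT: not about NS regularity; HYPOTHETICAL profiles.  No item is closed by this file.
-/

noncomputable section

-- the summit and its single sub-problem share the name (CONVENTIONS §1), as in every Theorems file
set_option linter.dupNamespace false

namespace Summit.NavierStokesRegularity.NavierStokesRegularity.Theorems.HalfSpaceWindowDoorCirculationCarryingRigidityTransportRigidity

open MeasureTheory Set Function Filter Topology InnerProductSpace
open scoped RealInnerProductSpace InnerProductSpace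
open Literature.Analysis Literature.Analysis.UnboundedOperators
open Literature.Analysis.FluidPDE hiding eR
open Summit.NavierStokesRegularity.NavierStokesRegularity.Theses.HalfSpaceWindowDoor
open Summit.NavierStokesRegularity.NavierStokesRegularity.Theorems.HalfSpaceWindowDoorCirculationCarryingRigidityDefs
  (InDoorClass SignE3 e3)
open Summit.NavierStokesRegularity.NavierStokesRegularity.Theorems.AxisTwistDoorAveragedConeLiouvilleDefs
  (cylPt eT eR circ vortCirc)
open Summit.NavierStokesRegularity.NavierStokesRegularity.Theorems.AveragedConeLiouville.CircleStokes (hasDerivAt_circ)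
open Summit.NavierStokesRegularity.NavierStokesRegularity.Theorems.AveragedConeLiouville.CircMonotone (circ_zero circ_mono)
open Summit.NavierStokesRegularity.NavierStokesRegularity.Theorems.AveragedConeLiouville.FlatFlux (exists_cylPt_eq)
open Summit.NavierStokesRegularity.NavierStokesRegularity.Theorems.HalfSpaceWindowDoorCirculationCarryingRigidityCriticalStretchingAnalytic
  (analyticOnNhd_inner_curl_e3_slice)
open Summit.NavierStokesRegularity.NavierStokesRegularity.Theorems.HalfSpaceWindowDoorCirculationCarryingRigidityConeFluxSubsolution
  (signE3_atd contDiff_one_slice)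
open Summit.NavierStokesRegularity.NavierStokesRegularity.Theorems.HalfSpaceWindowDoorCirculationCarryingRigidityRadConeRigidity
  (inner_curl_e3_eq_zero_on_circle_of_const)

variable {C : ℝ} {v : ℝ → EuclideanSpace ℝ (Fin 3) → EuclideanSpace ℝ (Fin 3)}

/-- **PLANE RIGIDITY.**  A closed-hemisphere door-class profile whose circulation IN ONE PLANE `{x₃ = z₀}` of ONE slice `s₀` is saturated by a
disc `D(R, z₀)` (`Γ(R,z₀,s₀) = S` and `Γ(r,z₀,s₀) ≤ S` for all `r ≥ 0`) has `ω₃(s₀,·) ≡ 0` on that plane.  Beyond `R` the circulation is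
constant, so `ω₃(s₀,·)` vanishes on the planar region `{r > R}`; along every horizontal line of the plane the real-analytic `ω₃(s₀,·)` then
vanishes on a half-line, hence on the whole line. -/
theorem inner_curl_e3_eq_zero_of_saturated_plane (hv : InDoorClass C v) (hsign : SignE3 v) {s₀ : ℝ} (hs₀ : s₀ < 0)
    {R z₀ S : ℝ} (hR : 0 ≤ R) (hsat : circ v R z₀ s₀ = S) (hle : ∀ r : ℝ, 0 ≤ r → circ v r z₀ s₀ ≤ S) :
    ∀ x : EuclideanSpace ℝ (Fin 3), x 2 = z₀ → ⟪curl (v s₀) x, e3⟫ = 0 := by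
  have hv1 := contDiff_one_slice hv hs₀
  have hsign' : ∀ y, 0 ≤ ⟪curl (v s₀) y,
      Summit.NavierStokesRegularity.NavierStokesRegularity.Theorems.AxisTwistDoorAveragedConeLiouvilleDefs.e3⟫ :=
    fun y => signE3_atd hsign s₀ hs₀ y
  -- beyond `R` the circulation of the plane is constant `= S`
  have hconst : ∀ r : ℝ, R ≤ r → circ v r z₀ s₀ = S := fun r hr =>
    le_antisymm (hle r (hR.trans hr)) (hsat.symm.le.trans (circ_mono v hv1 (signE3_atd hsign) hs₀ hR hr z₀))
  -- `ω₃(s₀, ·) = 0` at the points of the plane with `y₁ > 0` and `y₀² + y₁² > (R + 1)²`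
  have hfar : ∀ y : EuclideanSpace ℝ (Fin 3), y 2 = z₀ → 0 < y 1 → (R + 1) ^ 2 < y 0 ^ 2 + y 1 ^ 2 →
      ⟪curl (v s₀) y, e3⟫ = 0 := by
    intro y hy2 hy1 hyR
    obtain ⟨r, θ, hr, hr2, hθ, hyeq⟩ := exists_cylPt_eq hy1
    have hRr : R + 1 < r := by
      have h0 : 0 ≤ R + 1 := by positivity
      nlinarith
    rw [← hyeq, hy2]
    refine inner_curl_e3_eq_zero_on_circle_of_const hv1 hsign' hr (c := S) ?_ hθ
    filter_upwards [Ioi_mem_nhds (show R < r by linarith)] with r' hr'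
    exact hconst r' (le_of_lt hr')
  -- restriction to the horizontal line `t ↦ x + t e₁` of the plane
  intro x hx
  set b : EuclideanSpace ℝ (Fin 3) := EuclideanSpace.single (1 : Fin 3) (1 : ℝ) with hb
  set f : ℝ → ℝ := fun t => ⟪curl (v s₀) (x + t • b), e3⟫ with hf
  have hfan : AnalyticOnNhd ℝ f univ := by
    have hline : AnalyticOnNhd ℝ (fun t : ℝ => x + t • b) univ :=
      analyticOnNhd_const.add ((analyticOnNhd_id (𝕜 := ℝ)).smul analyticOnNhd_const)
    exact (analyticOnNhd_inner_curl_e3_slice hv.1 hv.2.1 hv.2.2.1 hs₀).comp hline (mapsTo_univ _ _)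
  have hb0 : b 0 = 0 := by simp [hb]
  have hb1 : b 1 = 1 := by simp [hb]
  have hb2 : b 2 = 0 := by simp [hb]
  set T₀ : ℝ := |x 0| + |x 1| + R + 1 with hT₀
  have hzero : ∀ t : ℝ, T₀ < t → f t = 0 := by
    intro t ht
    have h0 : (x + t • b) 0 = x 0 := by simp [hb0]
    have h1 : (x + t • b) 1 = x 1 + t := by simp [hb1]
    have h2 : (x + t • b) 2 = z₀ := by simp [hb2, hx]
    refine hfar _ h2 ?_ ?_
    · rw [h1]
      have := neg_abs_le (x 1)
      have hR1 : 0 ≤ R := hR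
      linarith [abs_nonneg (x 0)]
    · rw [h0, h1]
      have hx1 : R + 1 + |x 0| < x 1 + t := by
        have := neg_abs_le (x 1)
        linarith
      have hpos : 0 ≤ R + 1 + |x 0| := by positivity
      nlinarith [sq_nonneg (x 0), abs_nonneg (x 0), sq_abs (x 0)]
  have hev : f =ᶠ[𝓝 (T₀ + 1)] 0 := by
    filter_upwards [Ioi_mem_nhds (show T₀ < T₀ + 1 by linarith)] with t ht
    exact hzero t ht
  have h := hfan.eqOn_zero_of_preconnected_of_eventuallyEq_zero isPreconnected_univ (mem_univ (T₀ + 1)) hev (mem_univ (0 : ℝ))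
  have hf0 : f 0 = ⟪curl (v s₀) x, e3⟫ := by simp [hf]
  rw [← hf0]
  exact h

/-- **Corollary.**  In the situation of `inner_curl_e3_eq_zero_of_saturated_plane` the plane carries NO circulation:
`Γ(r, z₀, s₀) = 0` for every `r` — in particular `S = 0`. -/
theorem circ_eq_zero_of_saturated_plane (hv : InDoorClass C v) (hsign : SignE3 v) {s₀ : ℝ} (hs₀ : s₀ < 0)
    {R z₀ S : ℝ} (hR : 0 ≤ R) (hsat : circ v R z₀ s₀ = S) (hle : ∀ r : ℝ, 0 ≤ r → circ v r z₀ s₀ ≤ S) :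
    ∀ r : ℝ, circ v r z₀ s₀ = 0 := by
  have hv1 := contDiff_one_slice hv hs₀
  have hω := inner_curl_e3_eq_zero_of_saturated_plane hv hsign hs₀ hR hsat hle
  intro r
  have hvort : ∀ r' : ℝ, vortCirc v r' z₀ s₀ = 0 := by
    intro r'
    have hint : (fun θ : ℝ => ⟪curl (v s₀) (cylPt r' θ z₀),
        Summit.NavierStokesRegularity.NavierStokesRegularity.Theorems.AxisTwistDoorAveragedConeLiouvilleDefs.e3⟫ * r') =
        fun _ => (0 : ℝ) := by
      funext θ
      have h2 : (cylPt r' θ z₀) 2 = z₀ := by simp [cylPt]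
      rw [show ⟪curl (v s₀) (cylPt r' θ z₀),
        Summit.NavierStokesRegularity.NavierStokesRegularity.Theorems.AxisTwistDoorAveragedConeLiouvilleDefs.e3⟫ = 0 from hω _ h2, zero_mul]
    unfold vortCirc
    rw [hint, intervalIntegral.integral_const, smul_zero]
  have hderiv : ∀ r' : ℝ, HasDerivAt (fun ρ => circ v ρ z₀ s₀) 0 r' := by
    intro r'
    have h := hasDerivAt_circ v hv1 r' z₀
    rw [hvort r'] at h
    exact h
  have hconst := is_const_of_deriv_eq_zero (f := fun ρ => circ v ρ z₀ s₀) (fun r' => (hderiv r').differentiableAt)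
    (fun r' => (hderiv r').deriv) r 0
  have h0 : circ v 0 z₀ s₀ = 0 := circ_zero v z₀ s₀
  simpa [h0] using hconst

/-- **Slice version.**  If on the slice `s₀` EVERY plane's circulation is saturated at radius `0` (i.e. `Γ(·,·,s₀) ≤ 0`), the slice is
poloidal: `ω₃(s₀,·) ≡ 0`. -/
theorem inner_curl_e3_eq_zero_of_circ_nonpos (hv : InDoorClass C v) (hsign : SignE3 v) {s₀ : ℝ} (hs₀ : s₀ < 0)
    (hle : ∀ r : ℝ, 0 ≤ r → ∀ z : ℝ, circ v r z s₀ ≤ 0) : ∀ x, ⟪curl (v s₀) x, e3⟫ = 0 := fun x =>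
  inner_curl_e3_eq_zero_of_saturated_plane hv hsign hs₀ le_rfl (circ_zero v (x 2) s₀) (fun r hr => hle r hr (x 2)) x rfl

end Summit.NavierStokesRegularity.NavierStokesRegularity.Theorems.HalfSpaceWindowDoorCirculationCarryingRigidityTransportRigidity

end
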